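import Literature.AlgebraicGeometry.Frobenioids.PadicKummerIsoOfFunctor
import HarnessLib

/-!
# Frobenioids II, Thm. 2.4 (i): the context isomorphism induced by `Ψ` when `Ker(Aut_C(A) → Aut_E(A_E)) ⊋ O^×(A)`
# (row (α), file D4 generalised to charts over a general base `B^temp(Π, Π°)⁰`)

Mochizuki, *The geometry of Frobenioids II*, Kyushu J. Math. **62** (2008) 401–460, §2, Definition 2.2 (i) p. 17
[cite: MochizukiFrdII2008, Def 2.2 (i) p.17]: "`G_A := Aut_C(A)/(Ker(Aut_C(A) → Aut_E(A_E)))` induced by the functor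
`C → E`"; Theorem 2.4 p. 19 [cite: MochizukiFrdII2008, Thm 2.4 (i) p.19]: "`Ψ : C₁ ⥲ C₂` — which … necessarily induces
a 1-compatible equivalence of categories `Ψ_Base : D₁ ⥲ D₂`, hence an outer isomorphism of topological groups
`Π₁ ⥲ Π₂` [cf. [Mzk2], Proposition 3.2; [Mzk2], Theorem A.4] that lies over an outer isomorphism of topological groups
`G₁ ⥲ G₂` [cf. Theorem 1.2, (ii)]. … `Ψ` … induces isomorphisms … `(G₁)_{A₁} ⥲ (G₂)_{A₂}`".

Definitions file (seat abc-iut-L1-t7, gen 5; successor residual "general `Π ≠ G_{ℚ_p}` base chart" of GAP row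
G-L1t7-α). Abc-iut-L1-t7 gen 4's file D4 (`PadicKummerIsoOfFunctor.lean`) constructs the isomorphism of Definition 2.2
contexts `GaloisChart.isoOfFunctor` induced by a fully faithful `Ψ` from the chart property
`hkerᵢ : Ker(Aut_C(Aᵢ) → Aut_E((Aᵢ)_E)) = O^×(Aᵢ)` — TRUE for the base of §2 with `Π = G_{ℚ_p}` (file D3b
`resAut_eq_one_iff`) but FALSE for a general `Π → G_{ℚ_p}` (the kernel contains every lift of
`(V · Ker(Π → G_{ℚ_p}) ∩ N_Π(V))/V`; sequel `PadicKummerGaloisChartRelCoset.lean`, `resK_eq_one_iff`). What the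
construction of `(G₁)_{A₁} ⥲ (G₂)_{A₂}` actually uses is only that **`Ψ` carries the kernel at `A₁` onto the kernel at
`A₂ = Ψ A₁`** (`hkerF`) — in print, the consequence of "`Ψ_Base` lies over an outer isomorphism `G₁ ⥲ G₂`", i.e. of the
1-compatibility of `Ψ_Base : D₁ ⥲ D₂` with the functors `Dᵢ → Eᵢ`. This file redoes D4 relative to `hkerF`:
`galEquivKer`, `isoOfFunctorKer` (reusing D4's `autEquiv`, `objMonoidEquiv`, `objMonoidEquiv_smul_aut` BY NAME), and
records that D4's hypotheses imply `hkerF` (`res_eq_one_iff_autEquiv_of_hker`) with the same resulting isomorphism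
(`galEquivKer_eq_galEquiv`). Nothing here concerns [IUTchIII]; classical.
-/

noncomputable section

namespace Literature.AlgebraicGeometry.Frobenioids

namespace PadicFrd

namespace Datum

namespace GaloisChart

open CategoryTheory Opposite Function Field IntermediateField
open Literature.NumberTheory.GaloisRepresentations
open PadicKummer PadicKummer.Def22Context

universe v₁ u₁ v₂ u₂

section General

variable {D₁ : Type u₁} [Category.{v₁} D₁] {D₂ : Type u₂} [Category.{v₂} D₂] {p₁ p₂ : ℕ} [Fact p₁.Prime]
  [Fact p₂.Prime] {d₁ : Datum D₁ p₁} {d₂ : Datum D₂ p₂} {A₁ : d₁.frobenioid}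
  {K₁ K₂ : Type} [Field K₁] [Field K₂] {L₁ : IntermediateField K₁ (AlgebraicClosure K₁)}
  {L₂ : IntermediateField K₂ (AlgebraicClosure K₂)}
  (F : d₁.frobenioid ⥤ d₂.frobenioid) [F.Full] [F.Faithful]
  (c₁ : d₁.GaloisChart A₁ K₁ L₁) (c₂ : d₂.GaloisChart (F.obj A₁) K₂ L₂)
  (hO : ∀ f : A₁ ⟶ A₁, f ∈ PreFrobenioid.endSubmonoid d₁.structureFunctor A₁ ↔
    F.map f ∈ PreFrobenioid.endSubmonoid d₂.structureFunctor (F.obj A₁))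
  (hkerF : ∀ α : Aut A₁, c₁.res α = 1 ↔ c₂.res (autEquiv F α) = 1)

/-- **File D4's hypotheses imply `hkerF`**: if `Ker(Aut_C(Aᵢ) → Aut_E((Aᵢ)_E)) = O^×(Aᵢ)` (`hkerᵢ`, the base of §2 with
`Π = G_{ℚ_p}`) and "`Ψ` preserves `O^⊳(−)`" (hO), then `Ψ` carries the kernel at `A₁` onto the kernel at `Ψ A₁`.
[cite: MochizukiFrdII2008, Thm 2.4 (i) p.19] -/
theorem res_eq_one_iff_autEquiv_of_hker
    (hO : ∀ f : A₁ ⟶ A₁, f ∈ PreFrobenioid.endSubmonoid d₁.structureFunctor A₁ ↔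
      F.map f ∈ PreFrobenioid.endSubmonoid d₂.structureFunctor (F.obj A₁))
    (hker₁ : ∀ α : Aut A₁, c₁.res α = 1 ↔ α.hom ∈ PreFrobenioid.endSubmonoid d₁.structureFunctor A₁)
    (hker₂ : ∀ β : Aut (F.obj A₁), c₂.res β = 1 ↔ β.hom ∈ PreFrobenioid.endSubmonoid d₂.structureFunctor (F.obj A₁))
    (α : Aut A₁) : c₁.res α = 1 ↔ c₂.res (autEquiv F α) = 1 :=
  (hker₁ α).trans ((hO α.hom).trans (hker₂ (autEquiv F α)).symm)

include hkerF in
/-- `Ψ` respects "same image in `Aut_E(A_E)`": if `res₁ α = res₁ α'` then `res₂ (Ψ α) = res₂ (Ψ α')` (`α⁻¹α'` lies in the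
kernel at `A₁`, carried by `Ψ` into the kernel at `Ψ A₁`). [cite: MochizukiFrdII2008, Thm 2.4 (i) p.19] -/
theorem res_autEquiv_eq_of_res_eq_ker {α α' : Aut A₁} (h : c₁.res α = c₁.res α') :
    c₂.res (autEquiv F α) = c₂.res (autEquiv F α') := by
  have h1 : c₁.res (α⁻¹ * α') = 1 := by rw [map_mul, map_inv, h, inv_mul_cancel]
  have h3 : c₂.res (autEquiv F (α⁻¹ * α')) = 1 := (hkerF _).mp h1
  rw [map_mul, map_inv, map_mul, map_inv, inv_mul_eq_one] at h3
  exact h3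

include hkerF in
/-- Conversely: if `res₂ (Ψ α) = res₂ (Ψ α')` then `res₁ α = res₁ α'`. [cite: MochizukiFrdII2008, Thm 2.4 (i) p.19] -/
theorem res_eq_of_res_autEquiv_eq_ker {α α' : Aut A₁} (h : c₂.res (autEquiv F α) = c₂.res (autEquiv F α')) :
    c₁.res α = c₁.res α' := by
  have h3 : c₂.res (autEquiv F (α⁻¹ * α')) = 1 := by rw [map_mul, map_inv, map_mul, map_inv, h, inv_mul_cancel]
  have h1 : c₁.res (α⁻¹ * α') = 1 := (hkerF _).mpr h3
  rw [map_mul, map_inv, inv_mul_eq_one] at h1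
  exact h1

/-- **`(G₁)_{A₁} ⥲ (G₂)_{A₂}` = `Gal(L₁/K₁) ⥲ Gal(L₂/K₂)` induced by `Ψ`** when `Ψ` carries the kernel of
`Aut_C(A₁) → Aut_E((A₁)_E)` onto that at `Ψ A₁`: `τ ↦ res₂ (Ψ α)` for any lift `α` of `τ`.
[cite: MochizukiFrdII2008, Thm 2.4 (i) p.19] -/
def galEquivKer : (L₁ ≃ₐ[K₁] L₁) ≃* (L₂ ≃ₐ[K₂] L₂) where
  toFun τ := c₂.res (autEquiv F (c₁.lift τ))
  invFun τ₂ := c₁.res ((autEquiv F).symm (c₂.lift τ₂))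
  left_inv τ := by
    change c₁.res ((autEquiv F).symm (c₂.lift (c₂.res (autEquiv F (c₁.lift τ))))) = τ
    have h : c₂.res (autEquiv F ((autEquiv F).symm (c₂.lift (c₂.res (autEquiv F (c₁.lift τ)))))) =
        c₂.res (autEquiv F (c₁.lift τ)) := by
      rw [MulEquiv.apply_symm_apply, c₂.res_lift]
    rw [res_eq_of_res_autEquiv_eq_ker F c₁ c₂ hkerF h, c₁.res_lift]
  right_inv τ₂ := by
    change c₂.res (autEquiv F (c₁.lift (c₁.res ((autEquiv F).symm (c₂.lift τ₂))))) = τ₂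
    rw [res_autEquiv_eq_of_res_eq_ker F c₁ c₂ hkerF (c₁.res_lift _), MulEquiv.apply_symm_apply, c₂.res_lift]
  map_mul' τ σ := by
    rw [← map_mul, ← map_mul]
    exact res_autEquiv_eq_of_res_eq_ker F c₁ c₂ hkerF (by rw [c₁.res_lift, map_mul, c₁.res_lift, c₁.res_lift])

/-- Unfolding `galEquivKer`. [cite: MochizukiFrdII2008, Thm 2.4 (i) p.19] -/
theorem galEquivKer_apply (τ : L₁ ≃ₐ[K₁] L₁) :
    galEquivKer F c₁ c₂ hkerF τ = c₂.res (autEquiv F (c₁.lift τ)) := rfl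

/-- **`res₂ (Ψ α) = galEquivKer (res₁ α)`** — the field `res_isoC` of the context isomorphism.
[cite: MochizukiFrdII2008, Thm 2.4 (i) p.19] -/
theorem galEquivKer_res (α : Aut A₁) : galEquivKer F c₁ c₂ hkerF (c₁.res α) = c₂.res (autEquiv F α) :=
  res_autEquiv_eq_of_res_eq_ker F c₁ c₂ hkerF (c₁.res_lift _)

/-- Under file D4's hypotheses, `galEquivKer` IS file D4's `galEquiv`. [cite: MochizukiFrdII2008, Thm 2.4 (i) p.19] -/
theorem galEquivKer_eq_galEquiv
    (hker₁ : ∀ α : Aut A₁, c₁.res α = 1 ↔ α.hom ∈ PreFrobenioid.endSubmonoid d₁.structureFunctor A₁)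
    (hker₂ : ∀ β : Aut (F.obj A₁), c₂.res β = 1 ↔ β.hom ∈ PreFrobenioid.endSubmonoid d₂.structureFunctor (F.obj A₁)) :
    galEquivKer F c₁ c₂ (res_eq_one_iff_autEquiv_of_hker F c₁ c₂ hO hker₁ hker₂) = galEquiv F c₁ c₂ hO hker₁ hker₂ :=
  MulEquiv.ext fun _ => rfl

/-- **Equivariance along `galEquivKer`** (the field `isoO_smul` of the context isomorphism): for the descended actions
(`galAction`), `Ψ (τ • f) = galEquivKer τ • Ψ f`. [cite: MochizukiFrdII2008, Thm 2.4 (i) p.20] -/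
theorem objMonoidEquiv_smul_ker (τ : L₁ ≃ₐ[K₁] L₁) (f : ObjMonoid d₁ A₁) :
    objMonoidEquiv F hO (letI := c₁.galAction; τ • f) =
      (letI := c₂.galAction; galEquivKer F c₁ c₂ hkerF τ • objMonoidEquiv F hO f) := by
  rw [c₁.galAction_smul, c₂.galAction_smul, objMonoidEquiv_smul_aut]
  exact c₂.smul_eq_of_res_eq (by rw [c₂.res_lift, galEquivKer_apply]) _

end General

/-! ### The context isomorphism (universe `0`) -/

section UniverseZero

variable {D₁ : Type} [SmallCategory D₁] {D₂ : Type} [SmallCategory D₂] {p₁ p₂ : ℕ} [Fact p₁.Prime]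
  [Fact p₂.Prime] {d₁ : Datum D₁ p₁} {d₂ : Datum D₂ p₂} {A₁ : d₁.frobenioid}
  {K₁ K₂ : Type} [Field K₁] [Field K₂] {L₁ : IntermediateField K₁ (AlgebraicClosure K₁)}
  {L₂ : IntermediateField K₂ (AlgebraicClosure K₂)} [Normal K₁ L₁] [FiniteDimensional K₁ L₁]
  [Normal K₂ L₂] [FiniteDimensional K₂ L₂]
  (F : d₁.frobenioid ⥤ d₂.frobenioid) [F.Full] [F.Faithful]
  (c₁ : d₁.GaloisChart A₁ K₁ L₁) (c₂ : d₂.GaloisChart (F.obj A₁) K₂ L₂)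
  (hO : ∀ f : A₁ ⟶ A₁, f ∈ PreFrobenioid.endSubmonoid d₁.structureFunctor A₁ ↔
    F.map f ∈ PreFrobenioid.endSubmonoid d₂.structureFunctor (F.obj A₁))
  (hkerF : ∀ α : Aut A₁, c₁.res α = 1 ↔ c₂.res (autEquiv F α) = 1)
  (H₁ : Subgroup (absoluteGaloisGroup K₁)) [H₁.Normal] (hH₁ : IsOpen (H₁ : Set (absoluteGaloisGroup K₁)))
  (H₂ : Subgroup (absoluteGaloisGroup K₂)) [H₂.Normal] (hH₂ : IsOpen (H₂ : Set (absoluteGaloisGroup K₂)))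
  (isoG : absoluteGaloisGroup K₁ ≃ₜ* absoluteGaloisGroup K₂)
  (houter : ∀ g : absoluteGaloisGroup K₁, resGal L₂ (isoG g) = galEquivKer F c₁ c₂ hkerF (resGal L₁ g))
  (map_H : H₁.map isoG.toMulEquiv.toMonoidHom = H₂) (hgal : IsGalois K₁ L₁ ↔ IsGalois K₂ L₂)

omit [FiniteDimensional K₁ L₁] [FiniteDimensional K₂ L₂] in
/-- The outer-isomorphism compatibility `houter` in its natural form: if `isoG` is compatible with `Ψ` on automorphisms
through the outer homomorphisms `G_{Kᵢ} ↠ Gal(Lᵢ/Kᵢ)` — "`Ψ_Base` lies over `G₁ ⥲ G₂`" — then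
`resGal L₂ ∘ isoG = galEquivKer ∘ resGal L₁`. [cite: MochizukiFrdII2008, Thm 2.4 (i) p.19] -/
theorem houter_of_compat_ker
    (h : ∀ (g : absoluteGaloisGroup K₁) (α : Aut A₁), c₁.res α = resGal L₁ g →
      c₂.res (autEquiv F α) = resGal L₂ (isoG g)) (g : absoluteGaloisGroup K₁) :
    resGal L₂ (isoG g) = galEquivKer F c₁ c₂ hkerF (resGal L₁ g) := by
  rw [galEquivKer_apply]
  exact (h g _ (c₁.res_lift _)).symm

/-- **The isomorphism of Definition 2.2 contexts induced by `Ψ`** between the contexts `ofChart cᵢ Hᵢ …` of `A₁`,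
`Ψ A₁` — from the fully faithful `Ψ`, "`Ψ` preserves `O^⊳(−)`" (hO), "`Ψ` carries `Ker(Aut_{C₁}(A₁) → Aut_{E₁})` onto
`Ker(Aut_{C₂}(Ψ A₁) → Aut_{E₂})`" (hkerF — `Ψ_Base` over `G₁ ⥲ G₂`) and the outer isomorphism (isoG, houter, map_H);
valid for charts over ANY base (in particular the general `B^temp(Π, Π°)⁰` of §2). [cite: MochizukiFrdII2008, Thm 2.4 (i) p.19] -/
def isoOfFunctorKer : (ofChart c₁ H₁ hH₁).Iso (ofChart c₂ H₂ hH₂) :=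
  letI := c₁.galAction; letI := c₂.galAction
  { isoC := autEquiv F
    isoO := objMonoidEquiv F hO
    isoE := galEquivKer F c₁ c₂ hkerF
    isoG := isoG
    res_isoC := fun α => (galEquivKer_res F c₁ c₂ hkerF α).symm
    isoO_smul := fun τ f => objMonoidEquiv_smul_ker F c₁ c₂ hO hkerF τ f
    outer_isoG := houter
    map_H := map_H
    isGalois_iff := hgal }

end UniverseZero

end GaloisChart

end Datum

end PadicFrd

end Literature.AlgebraicGeometry.Frobenioids

end
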